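import Literature.NumberTheory.Automorphic.HyperbolicDirichletForm
import HarnessLib

/-!
# A Caccioppoli inequality and the Laplacian of a cut-off product (DFI 1995, Prop. 4, support file)

Topic `Literature/NumberTheory/Sieve`.  Support file of the elementary (spectral-theory-free) proof
of Proposition 4 of W. Duke, J. B. Friedlander, H. Iwaniec, *Equidistribution of roots of a
quadratic congruence to prime moduli*, Ann. of Math. 141 (1995) (the pointwise bound for the
Poincaré series (14), which the paper takes from the pre-trace formula, Prop. 3 p. 431).  We bound
point values by local `L²`-norms of the function and of its Laplacian; this file supplies the two
Euclidean ingredients on an open set `U ⊆ ℂ`, for `F ∈ C²(U)` and compactly supported cut-offs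
`χ` inside `U`:

* `integral_weight_gradNormSq_le` — **Caccioppoli's inequality**
  `∫ χ² |∇F|² ≤ ∫_K |Δ_c F|² + (1 + 8L²) ∫_K |F|²` (`K = tsupport χ`, `|χ| ≤ 1`, `|∂χ| ≤ L`,
  `Δ_c = ∂ₓ² + ∂ᵧ²`), by Green's formula `∫ (Δ_c F) χ² F̄ = -∫ χ² |∇F|² - 2 ∫ χ F̄ ∇χ·∇F`
  (integration by parts, `integral_fderiv_fderiv_mul_eq_neg` of `HyperbolicDirichletForm.lean`)
  and the inequality `2ab ≤ a²/2 + 2b²`;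
* `norm_sq_laplacian_mul_le` — the pointwise bound
  `|Δ(χF)|² ≤ 3 |Δ_c F|² + 24 L₁² |∇F|² + 12 L₂² |F|²` on `K` (and `Δ(χF) = 0` off `K`) from the
  product rule `Δ(χF) = χ Δ_c F + 2 ∇χ·∇F + F Δ_c χ`.

Standard real analysis (e.g. Gilbarg–Trudinger, *Elliptic PDE of second order*, §8.3 for the
Caccioppoli device); nothing of the paper is formalised here.

## References

* W. Duke, J. B. Friedlander, H. Iwaniec, Ann. of Math. (2) 141 (1995), 423–441, Prop. 3–4.
  [cite: DukeFriedlanderIwaniec1995, §3]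
* H. Iwaniec, *Spectral Methods of Automorphic Forms*, GSM 53 (2002), Lemma 4.1 (Green's formula).
  [cite: Iwaniec2002, Lemma 4.1]
-/

noncomputable section

namespace Literature.NumberTheory.Sieve

open _root_.MeasureTheory _root_.Set _root_.Filter _root_.Complex
open _root_.Literature.NumberTheory.Automorphic
open scoped Real Topology ENNReal NNReal ComplexConjugate Laplacian

namespace DFI1995

/-! ### Small calculus helpers -/

/-- `∂ₑ (conj ∘ F) = conj (∂ₑ F)`. [folklore] -/
theorem fderiv_conj_comp_apply (F : ℂ → ℂ) (z e : ℂ) :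
    fderiv ℝ (fun w => conj (F w)) z e = conj (fderiv ℝ F z e) := by
  have hfun : (fun w => conj (F w)) = Complex.conjCLE ∘ F := rfl
  rw [hfun, Complex.conjCLE.comp_fderiv]
  simp

/-- A product `a · b` with `a` continuous on an open `U` and `b` continuous, compactly supported
inside `U`, is integrable. [folklore] -/
theorem integrable_mul_of_tsupport_subset {U : Set ℂ} (hU : IsOpen U) {a b : ℂ → ℂ}
    (ha : ContinuousOn a U) (hb : Continuous b) (hbs : HasCompactSupport b) (hbU : tsupport b ⊆ U) :
    Integrable (fun z => a z * b z) :=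
  (continuous_mul_of_tsupport_subset hU ha hb hbU).integrable_of_hasCompactSupport hbs.mul_left

/-- Off the topological support of `b`, the derivative of `b` vanishes. [folklore] -/
theorem fderiv_eq_zero_of_notMem_tsupport {b : ℂ → ℂ} {z : ℂ} (hz : z ∉ tsupport b) :
    fderiv ℝ b z = 0 := by
  have h0 : b =ᶠ[𝓝 z] (fun _ => 0) := notMem_tsupport_iff_eventuallyEq.mp hz
  rw [h0.fderiv_eq]
  exact fderiv_const_apply 0

/-- `tsupport` of the complexification `z ↦ (χ z : ℂ)` is `tsupport χ`. [folklore] -/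
theorem tsupport_ofReal_comp (χ : ℂ → ℝ) : tsupport (fun z => (χ z : ℂ)) = tsupport χ := by
  unfold tsupport
  congr 1
  ext z
  simp [Function.mem_support]

/-! ### Caccioppoli's inequality -/

/-- **Caccioppoli's inequality.** Let `U ⊆ ℂ` be open, `F ∈ C²(U)`, and `χ ∈ C¹_c` real with
`tsupport χ ⊆ U`, `|χ| ≤ 1` and `|∂ₓχ|, |∂ᵧχ| ≤ L`.  Then, with `K = tsupport χ` and
`Δ_c F = ∂ₓ²F + ∂ᵧ²F`,
`∫_K χ² (|∂ₓF|² + |∂ᵧF|²) ≤ ∫_K |Δ_c F|² + (1 + 8 L²) ∫_K |F|²`.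
[cite: Iwaniec2002, Lemma 4.1 (Green's formula); folklore (Caccioppoli)] -/
theorem integral_weight_gradNormSq_le {U : Set ℂ} (hU : IsOpen U) {F : ℂ → ℂ} (hF : ContDiffOn ℝ 2 F U)
    {χ : ℂ → ℝ} (hχ : ContDiff ℝ 1 χ) (hχs : HasCompactSupport χ) (hχU : tsupport χ ⊆ U)
    (hχ1 : ∀ z, |χ z| ≤ 1) {L : ℝ}
    (hL : ∀ z, ‖fderiv ℝ (fun w => (χ w : ℂ)) z 1‖ ≤ L ∧ ‖fderiv ℝ (fun w => (χ w : ℂ)) z I‖ ≤ L) :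
    ∫ z in tsupport χ, χ z ^ 2 * (‖fderiv ℝ F z 1‖ ^ 2 + ‖fderiv ℝ F z I‖ ^ 2) ≤
      (∫ z in tsupport χ,
        ‖fderiv ℝ (fun w => fderiv ℝ F w 1) z 1 + fderiv ℝ (fun w => fderiv ℝ F w I) z I‖ ^ 2) +
        (1 + 8 * L ^ 2) * ∫ z in tsupport χ, ‖F z‖ ^ 2 := by
  -- names
  set K : Set ℂ := tsupport χ with hKdef
  have hK : IsCompact K := hχs
  set χc : ℂ → ℂ := fun w => (χ w : ℂ) with hχcdef
  have hχc : ContDiff ℝ 1 χc := Complex.ofRealCLM.contDiff.comp hχ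
  have hχcc : Continuous χc := hχc.continuous
  have hKc : tsupport χc = K := tsupport_ofReal_comp χ
  have hχcs : HasCompactSupport χc := by rw [HasCompactSupport, hKc]; exact hK
  set D₁ : ℂ → ℂ := fun z => fderiv ℝ F z 1 with hD₁
  set D₂ : ℂ → ℂ := fun z => fderiv ℝ F z I with hD₂
  set D₁₁ : ℂ → ℂ := fun z => fderiv ℝ (fun w => fderiv ℝ F w 1) z 1 with hD₁₁
  set D₂₂ : ℂ → ℂ := fun z => fderiv ℝ (fun w => fderiv ℝ F w I) z I with hD₂₂
  set X₁ : ℂ → ℂ := fun z => fderiv ℝ χc z 1 with hX₁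
  set X₂ : ℂ → ℂ := fun z => fderiv ℝ χc z I with hX₂
  -- regularity on `U`
  have hF1 : ContDiffOn ℝ 1 F U := hF.of_le (by norm_num)
  have hFc : ContinuousOn F U := hF.continuousOn
  have hFd : ∀ z ∈ U, DifferentiableAt ℝ F z := fun z hz =>
    (hF1.differentiableOn one_ne_zero).differentiableAt (hU.mem_nhds hz)
  have hDc : ∀ e, ContinuousOn (fun z => fderiv ℝ F z e) U := fun e =>
    (hF.continuousOn_fderiv_of_isOpen hU (by norm_num)).clm_apply continuousOn_const
  have hDF1 : ∀ e, ContDiffOn ℝ 1 (fun w => fderiv ℝ F w e) U := fun e =>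
    (hF.fderiv_of_isOpen hU (by norm_num)).clm_apply contDiffOn_const
  have hD2c : ∀ e, ContinuousOn (fun z => fderiv ℝ (fun w => fderiv ℝ F w e) z e) U := fun e =>
    ((hDF1 e).continuousOn_fderiv_of_isOpen hU le_rfl).clm_apply continuousOn_const
  have hXc : ∀ e, Continuous (fun z => fderiv ℝ χc z e) := fun e =>
    (hχc.continuous_fderiv one_ne_zero).clm_apply continuous_const
  have hXs : ∀ e, HasCompactSupport (fun z => fderiv ℝ χc z e) := fun e => hχcs.fderiv_apply (𝕜 := ℝ) e
  have hXU : ∀ e, tsupport (fun z => fderiv ℝ χc z e) ⊆ U := fun e =>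
    (tsupport_fderiv_apply_subset ℝ e).trans (hKc.symm ▸ hχU)
  have hχd : ∀ z, DifferentiableAt ℝ χc z := fun z => hχc.differentiable one_ne_zero z
  -- the test function `G = χ² F̄`
  set G : ℂ → ℂ := fun z => χc z * χc z * conj (F z) with hGdef
  have hconjF : ContDiffOn ℝ 1 (fun z => conj (F z)) U := Complex.conjCLE.contDiff.comp_contDiffOn hF1
  have hG1 : ContDiffOn ℝ 1 G U := ((hχc.mul hχc).contDiffOn).mul hconjF
  have hGK : tsupport G ⊆ K := by
    refine (closure_mono fun z hz => ?_).trans (subset_of_eq hKc)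
    rw [Function.mem_support] at hz ⊢
    intro h0; apply hz; simp only [hGdef, h0, zero_mul]
  have hGU : tsupport G ⊆ U := hGK.trans hχU
  have hGs : HasCompactSupport G := IsCompact.of_isClosed_subset hK (isClosed_tsupport _) hGK
  -- the derivative of `G`
  have hGd : ∀ z e, fderiv ℝ G z e = 2 * χc z * fderiv ℝ χc z e * conj (F z) +
      χc z * χc z * conj (fderiv ℝ F z e) := by
    intro z e
    by_cases hz : z ∈ U
    · have hd1 : DifferentiableAt ℝ (fun w => χc w * χc w) z := (hχd z).mul (hχd z)
      have hd2 : DifferentiableAt ℝ (fun w => conj (F w)) z :=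
        (hconjF.differentiableOn one_ne_zero).differentiableAt (hU.mem_nhds hz)
      have h := fderiv_fun_mul hd1 hd2
      have h' := fderiv_fun_mul (hχd z) (hχd z)
      rw [hGdef, h]
      simp only [add_apply, smul_apply, smul_eq_mul, h', fderiv_conj_comp_apply]
      ring
    · have hzK : z ∉ K := fun h => hz (hχU h)
      have hzG : z ∉ tsupport G := fun h => hzK (hGK h)
      have hχ0 : χc z = 0 := by
        have : z ∉ tsupport χc := by rwa [hKc]
        exact image_eq_zero_of_notMem_tsupport this
      rw [fderiv_eq_zero_of_notMem_tsupport hzG, hχ0]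
      simp
  -- integration by parts, `e = 1, I`
  have hIBP : ∀ e, e = 1 ∨ e = I →
      ∫ z, fderiv ℝ (fun w => fderiv ℝ F w e) z e * G z =
        -(2 * ∫ z, fderiv ℝ F z e * conj (F z) * (χc z * fderiv ℝ χc z e)) -
          ∫ z, fderiv ℝ F z e * conj (fderiv ℝ F z e) * (χc z * χc z) := by
    intro e he
    rw [integral_fderiv_fderiv_mul_eq_neg hU hF hG1 hGs hGU he]
    have hi1 : Integrable (fun z => fderiv ℝ F z e * conj (F z) * (χc z * fderiv ℝ χc z e)) :=
      integrable_mul_of_tsupport_subset hU ((hDc e).mul (Complex.continuous_conj.comp_continuousOn hFc))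
        (hχcc.mul (hXc e)) ((hXs e).mul_left) ((tsupport_mul_subset_right).trans (hXU e))
    have hi2 : Integrable (fun z => fderiv ℝ F z e * conj (fderiv ℝ F z e) * (χc z * χc z)) :=
      integrable_mul_of_tsupport_subset hU
        ((hDc e).mul (Complex.continuous_conj.comp_continuousOn (hDc e)))
        (hχcc.mul hχcc) (hχcs.mul_left) ((tsupport_mul_subset_right).trans (hKc.symm ▸ hχU))
    suffices h : ∫ z, fderiv ℝ F z e * fderiv ℝ G z e =
        2 * (∫ z, fderiv ℝ F z e * conj (F z) * (χc z * fderiv ℝ χc z e)) +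
          ∫ z, fderiv ℝ F z e * conj (fderiv ℝ F z e) * (χc z * χc z) by
      rw [h]; ring
    rw [← integral_const_mul, ← integral_add (hi1.const_mul 2) hi2]
    refine integral_congr_ae (Eventually.of_forall fun z => ?_)
    simp only [hGd z e]
    ring
  -- sum of the two directions: the complex identity
  have hLapG : Integrable (fun z => (D₁₁ z + D₂₂ z) * G z) :=
    integrable_mul_of_tsupport_subset hU ((hD2c 1).add (hD2c I))
      (contDiff_of_contDiffOn_of_tsupport_subset hU hG1 hGU).continuous hGs hGU
  have hI₁ := hIBP 1 (Or.inl rfl)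
  have hI₂ := hIBP I (Or.inr rfl)
  -- every integrand vanishes off `K`; pass to set integrals over `K` and to real parts
  have hχK : ∀ z, z ∉ K → χc z = 0 := fun z hz => by
    have : z ∉ tsupport χc := by rwa [hKc]
    exact image_eq_zero_of_notMem_tsupport this
  have hXK : ∀ z e, z ∉ K → fderiv ℝ χc z e = 0 := fun z e hz => by
    have : z ∉ tsupport χc := by rwa [hKc]
    rw [fderiv_eq_zero_of_notMem_tsupport this]; rfl
  -- continuity on `K` of the real integrands
  have hKU : K ⊆ U := hχU
  have hnD : ∀ e, ContinuousOn (fun z => ‖fderiv ℝ F z e‖) K := fun e => ((hDc e).mono hKU).norm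
  have hnF : ContinuousOn (fun z => ‖F z‖) K := (hFc.mono hKU).norm
  have hχK' : ContinuousOn χ K := hχ.continuous.continuousOn
  have hgradI : IntegrableOn (fun z => χ z ^ 2 * (‖D₁ z‖ ^ 2 + ‖D₂ z‖ ^ 2)) K :=
    ContinuousOn.integrableOn_compact hK ((hχK'.pow 2).mul (((hnD 1).pow 2).add ((hnD I).pow 2)))
  have hFI : IntegrableOn (fun z => ‖F z‖ ^ 2) K := ContinuousOn.integrableOn_compact hK (hnF.pow 2)
  have hLapI : IntegrableOn (fun z => ‖D₁₁ z + D₂₂ z‖ ^ 2) K :=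
    ContinuousOn.integrableOn_compact hK ((((hD2c 1).add (hD2c I)).mono hKU).norm.pow 2)
  -- (a) the gradient term is the real part of `∑ₑ ∫ Dₑ conj(Dₑ) χ²`
  have hA : ∀ e, (∫ z, fderiv ℝ F z e * conj (fderiv ℝ F z e) * (χc z * χc z)).re =
      ∫ z in K, χ z ^ 2 * ‖fderiv ℝ F z e‖ ^ 2 := by
    intro e
    rw [← setIntegral_eq_integral_of_forall_compl_eq_zero (s := K) (fun z hz => by
      rw [hχK z hz]; simp)]
    have hint : IntegrableOn (fun z => fderiv ℝ F z e * conj (fderiv ℝ F z e) * (χc z * χc z)) K :=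
      ContinuousOn.integrableOn_compact hK ((((hDc e).mul
        (Complex.continuous_conj.comp_continuousOn (hDc e))).mono hKU).mul
        ((hχcc.mul hχcc).continuousOn))
    have hre := integral_re hint
    simp only [RCLike.re_to_complex] at hre
    rw [← hre]
    refine integral_congr_ae (Eventually.of_forall fun z => ?_)
    have hz : fderiv ℝ F z e * conj (fderiv ℝ F z e) * (χc z * χc z) =
        ((‖fderiv ℝ F z e‖ ^ 2 * (χ z * χ z) : ℝ) : ℂ) := by
      rw [Complex.mul_conj, Complex.normSq_eq_norm_sq]
      simp only [hχcdef]
      push_cast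
      ring
    simp only [hz, Complex.ofReal_re]
    ring
  -- (b) the Laplacian term
  have hB : ‖∫ z, (D₁₁ z + D₂₂ z) * G z‖ ≤
      (1 / 2) * ((∫ z in K, ‖D₁₁ z + D₂₂ z‖ ^ 2) + ∫ z in K, ‖F z‖ ^ 2) := by
    rw [← setIntegral_eq_integral_of_forall_compl_eq_zero (s := K) (fun z hz => by
      simp only [hGdef, hχK z hz, zero_mul, mul_zero])]
    refine (norm_integral_le_integral_norm _).trans ?_
    rw [← integral_add hLapI hFI, ← integral_const_mul]
    refine integral_mono_of_nonneg (Eventually.of_forall fun z => norm_nonneg _)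
      ((hLapI.add hFI).const_mul _) (Eventually.of_forall fun z => ?_)
    have hχz : |χ z| ≤ 1 := hχ1 z
    have h1 : ‖G z‖ ≤ ‖F z‖ := by
      simp only [hGdef, norm_mul, Complex.norm_conj, hχcdef, Complex.norm_real, Real.norm_eq_abs]
      have : |χ z| * |χ z| ≤ 1 := by nlinarith [abs_nonneg (χ z)]
      nlinarith [norm_nonneg (F z), abs_nonneg (χ z)]
    dsimp only
    rw [norm_mul]
    nlinarith [norm_nonneg (D₁₁ z + D₂₂ z), norm_nonneg (G z), norm_nonneg (F z),
      sq_nonneg (‖D₁₁ z + D₂₂ z‖ - ‖F z‖)]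
  -- (c) the cross terms
  have hC : ∀ e, e = 1 ∨ e = I → ‖∫ z, fderiv ℝ F z e * conj (F z) * (χc z * fderiv ℝ χc z e)‖ ≤
      (1 / 4) * (∫ z in K, χ z ^ 2 * ‖fderiv ℝ F z e‖ ^ 2) + L ^ 2 * ∫ z in K, ‖F z‖ ^ 2 := by
    intro e he
    have hLe : ∀ z, ‖fderiv ℝ χc z e‖ ≤ L := fun z => by
      rcases he with rfl | rfl
      · exact (hL z).1
      · exact (hL z).2
    rw [← setIntegral_eq_integral_of_forall_compl_eq_zero (s := K) (fun z hz => by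
      rw [hχK z hz]; simp)]
    refine (norm_integral_le_integral_norm _).trans ?_
    have hi1 : IntegrableOn (fun z => χ z ^ 2 * ‖fderiv ℝ F z e‖ ^ 2) K :=
      ContinuousOn.integrableOn_compact hK ((hχK'.pow 2).mul ((hnD e).pow 2))
    rw [← integral_const_mul, ← integral_const_mul, ← integral_add (hi1.const_mul _) (hFI.const_mul _)]
    refine integral_mono_of_nonneg (Eventually.of_forall fun z => norm_nonneg _)
      ((hi1.const_mul _).add (hFI.const_mul _)) (Eventually.of_forall fun z => ?_)
    have hXz := hLe z
    dsimp only
    simp only [norm_mul, Complex.norm_conj, hχcdef, Complex.norm_real, Real.norm_eq_abs]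
    rw [show χ z ^ 2 = |χ z| ^ 2 from (sq_abs _).symm]
    have hprod : ‖fderiv ℝ F z e‖ * ‖F z‖ * (|χ z| * ‖fderiv ℝ (fun w => (χ w : ℂ)) z e‖) ≤
        ‖fderiv ℝ F z e‖ * ‖F z‖ * (|χ z| * L) :=
      mul_le_mul_of_nonneg_left (mul_le_mul_of_nonneg_left hXz (abs_nonneg _)) (by positivity)
    nlinarith [norm_nonneg (fderiv ℝ F z e), norm_nonneg (F z), abs_nonneg (χ z),
      sq_nonneg (|χ z| * ‖fderiv ℝ F z e‖ - 2 * L * ‖F z‖), hprod]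
  -- assemble: `I₁ + I₂ = re(A₁ + A₂)`, `A₁ + A₂ = -S - 2(C₁ + C₂)`
  have hLap1 : Integrable (fun z => D₁₁ z * G z) :=
    integrable_mul_of_tsupport_subset hU (hD2c 1)
      (contDiff_of_contDiffOn_of_tsupport_subset hU hG1 hGU).continuous hGs hGU
  have hLap2 : Integrable (fun z => D₂₂ z * G z) :=
    integrable_mul_of_tsupport_subset hU (hD2c I)
      (contDiff_of_contDiffOn_of_tsupport_subset hU hG1 hGU).continuous hGs hGU
  have hsum : (∫ z, (D₁₁ z + D₂₂ z) * G z) = (∫ z, D₁₁ z * G z) + ∫ z, D₂₂ z * G z := by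
    rw [← integral_add hLap1 hLap2]
    refine integral_congr_ae (Eventually.of_forall fun z => ?_)
    simp only [add_mul]
  have hi₁ : IntegrableOn (fun z => χ z ^ 2 * ‖D₁ z‖ ^ 2) K :=
    ContinuousOn.integrableOn_compact hK ((hχK'.pow 2).mul ((hnD 1).pow 2))
  have hi₂ : IntegrableOn (fun z => χ z ^ 2 * ‖D₂ z‖ ^ 2) K :=
    ContinuousOn.integrableOn_compact hK ((hχK'.pow 2).mul ((hnD I).pow 2))
  have hsplit : ∫ z in K, χ z ^ 2 * (‖D₁ z‖ ^ 2 + ‖D₂ z‖ ^ 2) =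
      (∫ z in K, χ z ^ 2 * ‖D₁ z‖ ^ 2) + ∫ z in K, χ z ^ 2 * ‖D₂ z‖ ^ 2 := by
    rw [← integral_add hi₁ hi₂]
    refine integral_congr_ae (Eventually.of_forall fun z => ?_)
    simp only [mul_add]
  have hAe : (∫ z, fderiv ℝ F z 1 * conj (fderiv ℝ F z 1) * (χc z * χc z)) +
      (∫ z, fderiv ℝ F z I * conj (fderiv ℝ F z I) * (χc z * χc z)) =
      -(∫ z, (D₁₁ z + D₂₂ z) * G z) -
        2 * ((∫ z, fderiv ℝ F z 1 * conj (F z) * (χc z * fderiv ℝ χc z 1)) +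
          ∫ z, fderiv ℝ F z I * conj (F z) * (χc z * fderiv ℝ χc z I)) := by
    rw [hsum]
    change (∫ z, D₁₁ z * G z) = _ at hI₁
    change (∫ z, D₂₂ z * G z) = _ at hI₂
    rw [hI₁, hI₂]
    ring
  have hre : (∫ z in K, χ z ^ 2 * ‖D₁ z‖ ^ 2) + (∫ z in K, χ z ^ 2 * ‖D₂ z‖ ^ 2) =
      ((∫ z, fderiv ℝ F z 1 * conj (fderiv ℝ F z 1) * (χc z * χc z)) +
        (∫ z, fderiv ℝ F z I * conj (fderiv ℝ F z I) * (χc z * χc z))).re := by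
    rw [Complex.add_re, hA 1, hA I]
  have hn2 : ‖(2 : ℂ)‖ = 2 := by simp
  have hbound : ((∫ z, fderiv ℝ F z 1 * conj (fderiv ℝ F z 1) * (χc z * χc z)) +
        (∫ z, fderiv ℝ F z I * conj (fderiv ℝ F z I) * (χc z * χc z))).re ≤
      ‖∫ z, (D₁₁ z + D₂₂ z) * G z‖ +
        2 * (‖∫ z, fderiv ℝ F z 1 * conj (F z) * (χc z * fderiv ℝ χc z 1)‖ +
          ‖∫ z, fderiv ℝ F z I * conj (F z) * (χc z * fderiv ℝ χc z I)‖) := by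
    refine (Complex.re_le_norm _).trans ?_
    rw [hAe]
    refine (norm_sub_le _ _).trans ?_
    rw [norm_neg, norm_mul, hn2]
    exact add_le_add le_rfl (mul_le_mul_of_nonneg_left (norm_add_le _ _) (by norm_num))
  have hc₁ := hC 1 (Or.inl rfl)
  have hc₂ := hC I (Or.inr rfl)
  rw [hsplit]
  linarith [hbound, hB, hc₁, hc₂, hre]

/-! ### The Laplacian of a cut-off product -/

/-- For a global `C²` function the Laplacian is the sum of the two coordinate second partials.
[folklore] -/
theorem laplacian_eq_fderiv_fderiv {g : ℂ → ℂ} (hg : ContDiff ℝ 2 g) (z : ℂ) :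
    Δ g z = fderiv ℝ (fun w => fderiv ℝ g w 1) z 1 + fderiv ℝ (fun w => fderiv ℝ g w I) z I := by
  rw [InnerProductSpace.laplacian_eq_iteratedFDeriv_complexPlane]
  simp only [iteratedFDeriv_two_apply, Fin.isValue, Matrix.cons_val_zero, Matrix.cons_val_one]
  rw [fderiv_fderiv_apply_eq isOpen_univ hg.contDiffOn (mem_univ z),
    fderiv_fderiv_apply_eq isOpen_univ hg.contDiffOn (mem_univ z)]

/-- Off the topological support the Laplacian vanishes. [folklore] -/
theorem laplacian_eq_zero_of_notMem_tsupport {g : ℂ → ℂ} {z : ℂ} (hz : z ∉ tsupport g) : Δ g z = 0 := by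
  have h0 : iteratedFDeriv ℝ 2 g z = 0 := by
    by_contra h
    exact hz (support_iteratedFDeriv_subset 2 (Function.mem_support.2 h))
  rw [InnerProductSpace.laplacian_eq_iteratedFDeriv_complexPlane]
  simp [h0]

/-- **The cut-off product and its Laplacian.** Let `U ⊆ ℂ` be open, `F ∈ C²(U)`, `χ ∈ C²_c` real
with `|χ| ≤ 1`, `|∂χ| ≤ L₁`, `|∂ₑ∂ₑχ| ≤ L₂`, and `χ' ∈ C¹_c` real with `tsupport χ' ⊆ U`, `|χ'| ≤ 1`,
`|∂χ'| ≤ L'` and `χ' = 1` on `tsupport χ`.  Then `g = χ F ∈ C²_c(ℂ)`, `‖g‖₂² ≤ ∫_{K'} |F|²` and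
`‖Δ g‖₂² ≤ (3 + 24 L₁²) ∫_{K'} |Δ_c F|² + (24 L₁² (1 + 8 L'²) + 12 L₂²) ∫_{K'} |F|²`
(`K' = tsupport χ'`; product rule `Δ(χF) = χ Δ_c F + 2∇χ·∇F + F Δ_c χ` and Caccioppoli).
[folklore] -/
theorem cutoff_mul_estimates {U : Set ℂ} (hU : IsOpen U) {F : ℂ → ℂ} (hF : ContDiffOn ℝ 2 F U)
    {χ χ' : ℂ → ℝ} (hχ : ContDiff ℝ 2 χ) (hχs : HasCompactSupport χ)
    (hχ' : ContDiff ℝ 1 χ') (hχ's : HasCompactSupport χ') (hχ'U : tsupport χ' ⊆ U)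
    (hnest : ∀ z ∈ tsupport χ, χ' z = 1) (hχ1 : ∀ z, |χ z| ≤ 1) (hχ'1 : ∀ z, |χ' z| ≤ 1)
    {L₁ L₂ L' : ℝ}
    (hL₁ : ∀ z, ‖fderiv ℝ (fun w => (χ w : ℂ)) z 1‖ ≤ L₁ ∧ ‖fderiv ℝ (fun w => (χ w : ℂ)) z I‖ ≤ L₁)
    (hL₂ : ∀ z, ‖fderiv ℝ (fun w => fderiv ℝ (fun v => (χ v : ℂ)) w 1) z 1‖ ≤ L₂ ∧
      ‖fderiv ℝ (fun w => fderiv ℝ (fun v => (χ v : ℂ)) w I) z I‖ ≤ L₂)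
    (hL' : ∀ z, ‖fderiv ℝ (fun w => (χ' w : ℂ)) z 1‖ ≤ L' ∧ ‖fderiv ℝ (fun w => (χ' w : ℂ)) z I‖ ≤ L') :
    ContDiff ℝ 2 (fun z => (χ z : ℂ) * F z) ∧ HasCompactSupport (fun z => (χ z : ℂ) * F z) ∧
    (∫ z, ‖(χ z : ℂ) * F z‖ ^ 2 ≤ ∫ z in tsupport χ', ‖F z‖ ^ 2) ∧
    ∫ z, ‖Δ (fun z => (χ z : ℂ) * F z) z‖ ^ 2 ≤
      (3 + 24 * L₁ ^ 2) * (∫ z in tsupport χ',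
        ‖fderiv ℝ (fun w => fderiv ℝ F w 1) z 1 + fderiv ℝ (fun w => fderiv ℝ F w I) z I‖ ^ 2) +
      (24 * L₁ ^ 2 * (1 + 8 * L' ^ 2) + 12 * L₂ ^ 2) * ∫ z in tsupport χ', ‖F z‖ ^ 2 := by
  -- names and supports
  set K : Set ℂ := tsupport χ with hKdef
  set K' : Set ℂ := tsupport χ' with hK'def
  have hK : IsCompact K := hχs
  have hK' : IsCompact K' := hχ's
  have hKK' : K ⊆ K' := fun z hz => subset_tsupport _ (by
    rw [Function.mem_support, hnest z hz]; exact one_ne_zero)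
  have hχU : K ⊆ U := hKK'.trans hχ'U
  set χc : ℂ → ℂ := fun w => (χ w : ℂ) with hχcdef
  have hχc : ContDiff ℝ 2 χc := Complex.ofRealCLM.contDiff.comp hχ
  have hχcc : Continuous χc := hχc.continuous
  have hKc : tsupport χc = K := tsupport_ofReal_comp χ
  have hχcs : HasCompactSupport χc := by rw [HasCompactSupport, hKc]; exact hK
  have hχK : ∀ z, z ∉ K → χc z = 0 := fun z hz => by
    have : z ∉ tsupport χc := by rwa [hKc]
    exact image_eq_zero_of_notMem_tsupport this
  set g : ℂ → ℂ := fun z => χc z * F z with hgdef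
  have hgK : tsupport g ⊆ K := by
    refine (closure_mono fun z hz => ?_).trans (subset_of_eq hKc)
    rw [Function.mem_support] at hz ⊢
    intro h0; apply hz; simp only [hgdef, h0, zero_mul]
  have hgU : tsupport g ⊆ U := hgK.trans hχU
  have hgs : HasCompactSupport g := IsCompact.of_isClosed_subset hK (isClosed_tsupport _) hgK
  have hg2 : ContDiff ℝ 2 g := contDiff_of_contDiffOn_of_tsupport_subset hU (hχc.contDiffOn.mul hF) hgU
  -- regularity on `U`
  have hF1 : ContDiffOn ℝ 1 F U := hF.of_le (by norm_num)
  have hFc : ContinuousOn F U := hF.continuousOn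
  have hFd : ∀ z ∈ U, DifferentiableAt ℝ F z := fun z hz =>
    (hF1.differentiableOn one_ne_zero).differentiableAt (hU.mem_nhds hz)
  have hDc : ∀ e, ContinuousOn (fun z => fderiv ℝ F z e) U := fun e =>
    (hF.continuousOn_fderiv_of_isOpen hU (by norm_num)).clm_apply continuousOn_const
  have hDF1 : ∀ e, ContDiffOn ℝ 1 (fun w => fderiv ℝ F w e) U := fun e =>
    (hF.fderiv_of_isOpen hU (by norm_num)).clm_apply contDiffOn_const
  have hDd : ∀ e, ∀ z ∈ U, DifferentiableAt ℝ (fun w => fderiv ℝ F w e) z := fun e z hz =>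
    ((hDF1 e).differentiableOn one_ne_zero).differentiableAt (hU.mem_nhds hz)
  have hD2c : ∀ e, ContinuousOn (fun z => fderiv ℝ (fun w => fderiv ℝ F w e) z e) U := fun e =>
    ((hDF1 e).continuousOn_fderiv_of_isOpen hU le_rfl).clm_apply continuousOn_const
  have hχd : ∀ z, DifferentiableAt ℝ χc z := fun z => hχc.differentiable (by norm_num) z
  have hX1 : ∀ e, ContDiff ℝ 1 (fun w => fderiv ℝ χc w e) := fun e =>
    (hχc.fderiv_right (m := 1) (by norm_num)).clm_apply contDiff_const
  have hXd : ∀ e z, DifferentiableAt ℝ (fun w => fderiv ℝ χc w e) z := fun e z =>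
    (hX1 e).differentiable one_ne_zero z
  -- the second partials of `g` on `U`
  have hD2g : ∀ e, ∀ z ∈ U, fderiv ℝ (fun w => fderiv ℝ g w e) z e =
      χc z * fderiv ℝ (fun w => fderiv ℝ F w e) z e + 2 * fderiv ℝ χc z e * fderiv ℝ F z e +
        fderiv ℝ (fun w => fderiv ℝ χc w e) z e * F z := by
    intro e z hz
    have h1 : (fun w => fderiv ℝ g w e) =ᶠ[𝓝 z]
        fun w => fderiv ℝ χc w e * F w + χc w * fderiv ℝ F w e := by
      filter_upwards [hU.mem_nhds hz] with w hw
      rw [hgdef, fderiv_fun_mul (hχd w) (hFd w hw)]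
      simp only [add_apply, smul_apply, smul_eq_mul]
      ring
    rw [h1.fderiv_eq]
    have hA : DifferentiableAt ℝ (fun w => fderiv ℝ χc w e * F w) z := (hXd e z).mul (hFd z hz)
    have hB : DifferentiableAt ℝ (fun w => χc w * fderiv ℝ F w e) z := (hχd z).mul (hDd e z hz)
    rw [fderiv_fun_add hA hB]
    simp only [add_apply]
    rw [fderiv_fun_mul (hXd e z) (hFd z hz), fderiv_fun_mul (hχd z) (hDd e z hz)]
    simp only [add_apply, smul_apply, smul_eq_mul]
    ring
  -- the Laplacian of `g`: formula on `K`, zero off `K`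
  have hLapK : ∀ z ∈ K, Δ g z =
      χc z * (fderiv ℝ (fun w => fderiv ℝ F w 1) z 1 + fderiv ℝ (fun w => fderiv ℝ F w I) z I) +
      2 * (fderiv ℝ χc z 1 * fderiv ℝ F z 1 + fderiv ℝ χc z I * fderiv ℝ F z I) +
      (fderiv ℝ (fun w => fderiv ℝ χc w 1) z 1 + fderiv ℝ (fun w => fderiv ℝ χc w I) z I) * F z := by
    intro z hz
    rw [laplacian_eq_fderiv_fderiv hg2, hD2g 1 z (hχU hz), hD2g I z (hχU hz)]
    ring
  have hLap0 : ∀ z, z ∉ K → Δ g z = 0 := fun z hz =>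
    laplacian_eq_zero_of_notMem_tsupport fun h => hz (hgK h)
  -- the pointwise bound
  set Φ : ℂ → ℝ := fun z =>
    3 * ‖fderiv ℝ (fun w => fderiv ℝ F w 1) z 1 + fderiv ℝ (fun w => fderiv ℝ F w I) z I‖ ^ 2 +
      24 * L₁ ^ 2 * (‖fderiv ℝ F z 1‖ ^ 2 + ‖fderiv ℝ F z I‖ ^ 2) + 12 * L₂ ^ 2 * ‖F z‖ ^ 2 with hΦ
  have hpt : ∀ z ∈ K, ‖Δ g z‖ ^ 2 ≤ Φ z := by
    intro z hz
    rw [hLapK z hz]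
    set Lp := fderiv ℝ (fun w => fderiv ℝ F w 1) z 1 + fderiv ℝ (fun w => fderiv ℝ F w I) z I
    have hχz : ‖χc z‖ ≤ 1 := by
      simp only [hχcdef, Complex.norm_real, Real.norm_eq_abs]; exact hχ1 z
    obtain ⟨h11, h1I⟩ := hL₁ z
    obtain ⟨h21, h2I⟩ := hL₂ z
    have ha : ‖χc z * Lp‖ ≤ ‖Lp‖ := by
      rw [norm_mul]; exact mul_le_of_le_one_left (norm_nonneg _) hχz
    have hb : ‖2 * (fderiv ℝ χc z 1 * fderiv ℝ F z 1 + fderiv ℝ χc z I * fderiv ℝ F z I)‖ ≤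
        2 * L₁ * (‖fderiv ℝ F z 1‖ + ‖fderiv ℝ F z I‖) := by
      rw [norm_mul, Complex.norm_two]
      have h' : ‖fderiv ℝ χc z 1 * fderiv ℝ F z 1 + fderiv ℝ χc z I * fderiv ℝ F z I‖ ≤
          L₁ * ‖fderiv ℝ F z 1‖ + L₁ * ‖fderiv ℝ F z I‖ := by
        refine (norm_add_le _ _).trans ?_
        rw [norm_mul, norm_mul]
        exact add_le_add (mul_le_mul_of_nonneg_right h11 (norm_nonneg _))
          (mul_le_mul_of_nonneg_right h1I (norm_nonneg _))
      nlinarith [h']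
    have hc : ‖(fderiv ℝ (fun w => fderiv ℝ χc w 1) z 1 + fderiv ℝ (fun w => fderiv ℝ χc w I) z I) * F z‖ ≤
        2 * L₂ * ‖F z‖ := by
      rw [norm_mul]
      refine mul_le_mul_of_nonneg_right ((norm_add_le _ _).trans ?_) (norm_nonneg _)
      linarith
    have hL₁0 : 0 ≤ L₁ := (norm_nonneg _).trans h11
    have hL₂0 : 0 ≤ L₂ := (norm_nonneg _).trans h21
    have hsum := (norm_add₃_le).trans (add_le_add (add_le_add ha hb) hc)
    -- `(a + b + c)² ≤ 3(a² + b² + c²)` (cf. `MatomakiRadziwillL14.sq_add_three_le`)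
    have h3 : ∀ a₁ b₁ c₁ : ℝ, (a₁ + b₁ + c₁) ^ 2 ≤ 3 * (a₁ ^ 2 + b₁ ^ 2 + c₁ ^ 2) := fun a₁ b₁ c₁ => by
      nlinarith [sq_nonneg (a₁ - b₁), sq_nonneg (b₁ - c₁), sq_nonneg (a₁ - c₁)]
    have h3 := h3 ‖Lp‖ (2 * L₁ * (‖fderiv ℝ F z 1‖ + ‖fderiv ℝ F z I‖)) (2 * L₂ * ‖F z‖)
    have hsq : ‖χc z * Lp + 2 * (fderiv ℝ χc z 1 * fderiv ℝ F z 1 + fderiv ℝ χc z I * fderiv ℝ F z I) +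
        (fderiv ℝ (fun w => fderiv ℝ χc w 1) z 1 + fderiv ℝ (fun w => fderiv ℝ χc w I) z I) * F z‖ ^ 2 ≤
        (‖Lp‖ + 2 * L₁ * (‖fderiv ℝ F z 1‖ + ‖fderiv ℝ F z I‖) + 2 * L₂ * ‖F z‖) ^ 2 :=
      pow_le_pow_left₀ (norm_nonneg _) hsum 2
    simp only [hΦ]
    nlinarith [hsq, h3, sq_nonneg (‖fderiv ℝ F z 1‖ - ‖fderiv ℝ F z I‖), sq_nonneg L₁,
      norm_nonneg (fderiv ℝ F z 1), norm_nonneg (fderiv ℝ F z I)]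
  -- integrability on `K`, `K'`
  have hK'U : K' ⊆ U := hχ'U
  have hnD : ∀ e, ContinuousOn (fun z => ‖fderiv ℝ F z e‖) U := fun e => (hDc e).norm
  have hLapc : ContinuousOn (fun z =>
      ‖fderiv ℝ (fun w => fderiv ℝ F w 1) z 1 + fderiv ℝ (fun w => fderiv ℝ F w I) z I‖ ^ 2) U :=
    ((hD2c 1).add (hD2c I)).norm.pow 2
  have hgradc : ContinuousOn (fun z => ‖fderiv ℝ F z 1‖ ^ 2 + ‖fderiv ℝ F z I‖ ^ 2) U :=
    ((hnD 1).pow 2).add ((hnD I).pow 2)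
  have hF2c : ContinuousOn (fun z => ‖F z‖ ^ 2) U := hFc.norm.pow 2
  have hΦc : ContinuousOn Φ U :=
    ((continuousOn_const.mul hLapc).add (continuousOn_const.mul hgradc)).add (continuousOn_const.mul hF2c)
  have hΦI : IntegrableOn Φ K := ContinuousOn.integrableOn_compact hK (hΦc.mono hχU)
  have hLapI' : IntegrableOn (fun z =>
      ‖fderiv ℝ (fun w => fderiv ℝ F w 1) z 1 + fderiv ℝ (fun w => fderiv ℝ F w I) z I‖ ^ 2) K' :=
    ContinuousOn.integrableOn_compact hK' (hLapc.mono hK'U)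
  have hgradI' : IntegrableOn (fun z => χ' z ^ 2 * (‖fderiv ℝ F z 1‖ ^ 2 + ‖fderiv ℝ F z I‖ ^ 2)) K' :=
    ContinuousOn.integrableOn_compact hK' ((hχ'.continuous.continuousOn.pow 2).mul (hgradc.mono hK'U))
  have hFI' : IntegrableOn (fun z => ‖F z‖ ^ 2) K' := ContinuousOn.integrableOn_compact hK' (hF2c.mono hK'U)
  have hΔc : Continuous (Δ g) := by
    have e : Δ g = fun z => fderiv ℝ (fun w => fderiv ℝ g w 1) z 1 + fderiv ℝ (fun w => fderiv ℝ g w I) z I :=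
      funext (laplacian_eq_fderiv_fderiv hg2)
    rw [e]
    have h2 : ∀ e, Continuous (fun z => fderiv ℝ (fun w => fderiv ℝ g w e) z e) := fun e =>
      (((hg2.fderiv_right (m := 1) (by norm_num)).clm_apply contDiff_const).continuous_fderiv
        one_ne_zero).clm_apply continuous_const
    exact (h2 1).add (h2 I)
  -- monotonicity in the domain for the three nonnegative integrands
  have hmono : ∀ {f : ℂ → ℝ}, IntegrableOn f K' → (∀ z, 0 ≤ f z) → ∫ z in K, f z ≤ ∫ z in K', f z :=
    fun hf h0 => setIntegral_mono_set hf (Eventually.of_forall h0) (Eventually.of_forall hKK')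
  refine ⟨hg2, hgs, ?_, ?_⟩
  · -- `‖g‖₂² ≤ ∫_{K'} |F|²`
    rw [← setIntegral_eq_integral_of_forall_compl_eq_zero (s := K) (fun z hz => by
      have h0 : (χ z : ℂ) = 0 := hχK z hz
      simp [h0])]
    refine le_trans ?_ (hmono hFI' fun z => sq_nonneg _)
    refine setIntegral_mono_on (ContinuousOn.integrableOn_compact hK ?_) (hFI'.mono_set hKK')
      hK.measurableSet fun z hz => ?_
    · exact ((hχcc.continuousOn.mul (hFc.mono hχU)).norm.pow 2)
    · have hχz : ‖χc z‖ ≤ 1 := by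
        simp only [hχcdef, Complex.norm_real, Real.norm_eq_abs]; exact hχ1 z
      rw [norm_mul]
      have := mul_le_of_le_one_left (norm_nonneg (F z)) hχz
      exact pow_le_pow_left₀ (by positivity) this 2
  · -- `‖Δ g‖₂²`
    rw [← setIntegral_eq_integral_of_forall_compl_eq_zero (s := K) (fun z hz => by
      rw [hLap0 z hz, norm_zero]; norm_num)]
    have h1 : ∫ z in K, ‖Δ g z‖ ^ 2 ≤ ∫ z in K, Φ z :=
      setIntegral_mono_on (ContinuousOn.integrableOn_compact hK (hΔc.continuousOn.norm.pow 2)) hΦI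
        hK.measurableSet hpt
    have h2 : ∫ z in K, Φ z =
        3 * (∫ z in K, ‖fderiv ℝ (fun w => fderiv ℝ F w 1) z 1 + fderiv ℝ (fun w => fderiv ℝ F w I) z I‖ ^ 2) +
        24 * L₁ ^ 2 * (∫ z in K, (‖fderiv ℝ F z 1‖ ^ 2 + ‖fderiv ℝ F z I‖ ^ 2)) +
        12 * L₂ ^ 2 * ∫ z in K, ‖F z‖ ^ 2 := by
      have i1 := (hLapI'.mono_set hKK').const_mul 3
      have i2 := (ContinuousOn.integrableOn_compact (μ := volume) hK (hgradc.mono hχU)).const_mul (24 * L₁ ^ 2)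
      have i3 := (hFI'.mono_set hKK').const_mul (12 * L₂ ^ 2)
      have i12 : IntegrableOn (fun z =>
          3 * ‖fderiv ℝ (fun w => fderiv ℝ F w 1) z 1 + fderiv ℝ (fun w => fderiv ℝ F w I) z I‖ ^ 2 +
            24 * L₁ ^ 2 * (‖fderiv ℝ F z 1‖ ^ 2 + ‖fderiv ℝ F z I‖ ^ 2)) K := i1.add i2
      rw [← integral_const_mul, ← integral_const_mul, ← integral_const_mul, ← integral_add i1 i2,
        ← integral_add i12 i3]
    -- the gradient integral over `K` is dominated by the weighted one over `K'`
    have h3 : ∫ z in K, (‖fderiv ℝ F z 1‖ ^ 2 + ‖fderiv ℝ F z I‖ ^ 2) ≤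
        ∫ z in K', χ' z ^ 2 * (‖fderiv ℝ F z 1‖ ^ 2 + ‖fderiv ℝ F z I‖ ^ 2) := by
      have e1 : ∫ z in K, (‖fderiv ℝ F z 1‖ ^ 2 + ‖fderiv ℝ F z I‖ ^ 2) =
          ∫ z in K, χ' z ^ 2 * (‖fderiv ℝ F z 1‖ ^ 2 + ‖fderiv ℝ F z I‖ ^ 2) :=
        setIntegral_congr_fun hK.measurableSet fun z hz => by rw [hnest z hz]; ring
      rw [e1]
      exact hmono hgradI' fun z => by positivity
    have h4 := integral_weight_gradNormSq_le hU hF hχ' hχ's hχ'U hχ'1 hL'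
    have h5 := hmono hLapI' fun z => by positivity
    have h6 := hmono hFI' fun z => by positivity
    have hL0 : 0 ≤ 24 * L₁ ^ 2 := by positivity
    have hI0 : 0 ≤ ∫ z in K', ‖F z‖ ^ 2 := integral_nonneg fun z => by positivity
    calc ∫ z in K, ‖Δ g z‖ ^ 2 ≤ ∫ z in K, Φ z := h1
      _ = _ := h2
      _ ≤ 3 * (∫ z in K', ‖fderiv ℝ (fun w => fderiv ℝ F w 1) z 1 + fderiv ℝ (fun w => fderiv ℝ F w I) z I‖ ^ 2) +
          24 * L₁ ^ 2 * ((∫ z in K',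
            ‖fderiv ℝ (fun w => fderiv ℝ F w 1) z 1 + fderiv ℝ (fun w => fderiv ℝ F w I) z I‖ ^ 2) +
            (1 + 8 * L' ^ 2) * ∫ z in K', ‖F z‖ ^ 2) +
          12 * L₂ ^ 2 * ∫ z in K', ‖F z‖ ^ 2 := by
          gcongr
          · exact h3.trans h4
      _ = _ := by ring

/-! ### Cut-offs with uniform bounds (translates of one bump function) -/

/-- The operator norm controls the two coordinate partials. [folklore] -/
theorem norm_apply_one_I_le (A : ℂ →L[ℝ] ℂ) : ‖A 1‖ ≤ ‖A‖ ∧ ‖A I‖ ≤ ‖A‖ := by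
  constructor
  · simpa using A.le_opNorm 1
  · simpa using A.le_opNorm I

/-- **Uniform cut-offs.** For radii `0 < r₁ < r₂ < r₃` there are constants `L₁, L₂, L'` such that
around every centre `c ∈ ℂ` there are a `C²` cut-off `χ` (`χ(c) = 1`, `|χ| ≤ 1`, `|∂χ| ≤ L₁`,
`|∂ₑ∂ₑχ| ≤ L₂`, `tsupport χ ⊆ B̄(c, r₂)`) and a `C¹` cut-off `χ'` (`|χ'| ≤ 1`, `|∂χ'| ≤ L'`,
`χ' = 1` on `tsupport χ`, `tsupport χ' ⊆ B̄(c, r₃)`): translates of two fixed bump functions.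
[folklore] -/
theorem exists_uniform_cutoffs {r₁ r₂ r₃ : ℝ} (h₁ : 0 < r₁) (h₁₂ : r₁ < r₂) (h₂₃ : r₂ < r₃) :
    ∃ L₁ L₂ L' : ℝ, ∀ c : ℂ, ∃ χ χ' : ℂ → ℝ,
      ContDiff ℝ 2 χ ∧ HasCompactSupport χ ∧ ContDiff ℝ 1 χ' ∧ HasCompactSupport χ' ∧
      tsupport χ' ⊆ Metric.closedBall c r₃ ∧ (∀ z ∈ tsupport χ, χ' z = 1) ∧
      (∀ z, |χ z| ≤ 1) ∧ (∀ z, |χ' z| ≤ 1) ∧ χ c = 1 ∧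
      (∀ z, ‖fderiv ℝ (fun w => (χ w : ℂ)) z 1‖ ≤ L₁ ∧ ‖fderiv ℝ (fun w => (χ w : ℂ)) z I‖ ≤ L₁) ∧
      (∀ z, ‖fderiv ℝ (fun w => fderiv ℝ (fun v => (χ v : ℂ)) w 1) z 1‖ ≤ L₂ ∧
        ‖fderiv ℝ (fun w => fderiv ℝ (fun v => (χ v : ℂ)) w I) z I‖ ≤ L₂) ∧
      (∀ z, ‖fderiv ℝ (fun w => (χ' w : ℂ)) z 1‖ ≤ L' ∧ ‖fderiv ℝ (fun w => (χ' w : ℂ)) z I‖ ≤ L') := by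
  -- two bump functions at the origin
  let β : ContDiffBump (0 : ℂ) := ⟨r₁, r₂, h₁, h₁₂⟩
  let β' : ContDiffBump (0 : ℂ) := ⟨r₂, r₃, h₁.trans h₁₂, h₂₃⟩
  set b : ℂ → ℂ := fun w => ((β w : ℝ) : ℂ) with hb
  set b' : ℂ → ℂ := fun w => ((β' w : ℝ) : ℂ) with hb'
  have hb2 : ContDiff ℝ 2 b := Complex.ofRealCLM.contDiff.comp β.contDiff
  have hb'1 : ContDiff ℝ 1 b' := Complex.ofRealCLM.contDiff.comp β'.contDiff
  have hbs : HasCompactSupport b := β.hasCompactSupport.comp_left Complex.ofReal_zero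
  have hb's : HasCompactSupport b' := β'.hasCompactSupport.comp_left Complex.ofReal_zero
  -- bounds for the derivatives of the two fixed functions
  obtain ⟨L₁, hL₁⟩ := (hb2.continuous_fderiv (by norm_num)).bounded_above_of_compact_support
    (hbs.fderiv (𝕜 := ℝ))
  have hb2e : ∀ e, ContDiff ℝ 1 (fun w => fderiv ℝ b w e) := fun e =>
    (hb2.fderiv_right (m := 1) (by norm_num)).clm_apply contDiff_const
  obtain ⟨M₁, hM₁⟩ := ((hb2e 1).continuous_fderiv one_ne_zero).bounded_above_of_compact_support
    ((hbs.fderiv_apply (𝕜 := ℝ) 1).fderiv (𝕜 := ℝ))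
  obtain ⟨M₂, hM₂⟩ := ((hb2e I).continuous_fderiv one_ne_zero).bounded_above_of_compact_support
    ((hbs.fderiv_apply (𝕜 := ℝ) I).fderiv (𝕜 := ℝ))
  obtain ⟨L', hL'⟩ := (hb'1.continuous_fderiv one_ne_zero).bounded_above_of_compact_support
    (hb's.fderiv (𝕜 := ℝ))
  refine ⟨L₁, max M₁ M₂, L', fun c => ?_⟩
  refine ⟨fun z => β (z - c), fun z => β' (z - c), ?_, ?_, ?_, ?_, ?_, ?_, ?_, ?_, ?_, ?_, ?_, ?_⟩
  · exact β.contDiff.comp (contDiff_id.sub contDiff_const)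
  · refine IsCompact.of_isClosed_subset (isCompact_closedBall c r₂) (isClosed_tsupport _) ?_
    refine closure_minimal (fun z hz => ?_) Metric.isClosed_closedBall
    rw [Function.mem_support] at hz
    have : z - c ∈ Metric.ball (0 : ℂ) r₂ := by
      rw [← β.support_eq]; exact Function.mem_support.2 hz
    rw [Metric.mem_ball, dist_zero_right] at this
    rw [Metric.mem_closedBall, dist_eq_norm]; exact this.le
  · exact β'.contDiff.comp (contDiff_id.sub contDiff_const)
  · refine IsCompact.of_isClosed_subset (isCompact_closedBall c r₃) (isClosed_tsupport _) ?_
    refine closure_minimal (fun z hz => ?_) Metric.isClosed_closedBall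
    rw [Function.mem_support] at hz
    have : z - c ∈ Metric.ball (0 : ℂ) r₃ := by
      rw [← β'.support_eq]; exact Function.mem_support.2 hz
    rw [Metric.mem_ball, dist_zero_right] at this
    rw [Metric.mem_closedBall, dist_eq_norm]; exact this.le
  · refine closure_minimal (fun z hz => ?_) Metric.isClosed_closedBall
    rw [Function.mem_support] at hz
    have : z - c ∈ Metric.ball (0 : ℂ) r₃ := by
      rw [← β'.support_eq]; exact Function.mem_support.2 hz
    rw [Metric.mem_ball, dist_zero_right] at this
    rw [Metric.mem_closedBall, dist_eq_norm]; exact this.le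
  · intro z hz
    have hz' : z ∈ Metric.closedBall c r₂ := by
      refine closure_minimal (fun w hw => ?_) Metric.isClosed_closedBall hz
      rw [Function.mem_support] at hw
      have : w - c ∈ Metric.ball (0 : ℂ) r₂ := by
        rw [← β.support_eq]; exact Function.mem_support.2 hw
      rw [Metric.mem_ball, dist_zero_right] at this
      rw [Metric.mem_closedBall, dist_eq_norm]; exact this.le
    apply β'.one_of_mem_closedBall
    rw [Metric.mem_closedBall, dist_zero_right]
    rw [Metric.mem_closedBall, dist_eq_norm] at hz'
    exact hz'
  · intro z; rw [abs_of_nonneg β.nonneg]; exact β.le_one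
  · intro z; rw [abs_of_nonneg β'.nonneg]; exact β'.le_one
  · show β (c - c) = 1
    rw [sub_self]
    exact β.one_of_mem_closedBall (Metric.mem_closedBall_self h₁.le)
  · intro z
    have e1 : fderiv ℝ (fun w => ((β (w - c) : ℝ) : ℂ)) z = fderiv ℝ b (z - c) := fderiv_comp_sub (f := b) c
    rw [e1]
    obtain ⟨h1, h2⟩ := norm_apply_one_I_le (fderiv ℝ b (z - c))
    exact ⟨h1.trans (hL₁ _), h2.trans (hL₁ _)⟩
  · intro z
    have e0 : ∀ e, (fun w => fderiv ℝ (fun v => ((β (v - c) : ℝ) : ℂ)) w e) =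
        fun w => fderiv ℝ b (w - c) e := fun e => by
      funext w
      rw [show fderiv ℝ (fun v => ((β (v - c) : ℝ) : ℂ)) w = fderiv ℝ b (w - c) from fderiv_comp_sub (f := b) c]
    rw [e0 1, e0 I]
    have e1 : ∀ e, fderiv ℝ (fun w => fderiv ℝ b (w - c) e) z =
        fderiv ℝ (fun w => fderiv ℝ b w e) (z - c) := fun e =>
      fderiv_comp_sub (f := fun w => fderiv ℝ b w e) c
    rw [e1 1, e1 I]
    constructor
    · exact ((norm_apply_one_I_le _).1.trans (hM₁ _)).trans (le_max_left _ _)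
    · exact ((norm_apply_one_I_le _).2.trans (hM₂ _)).trans (le_max_right _ _)
  · intro z
    have e1 : fderiv ℝ (fun w => ((β' (w - c) : ℝ) : ℂ)) z = fderiv ℝ b' (z - c) := fderiv_comp_sub (f := b') c
    rw [e1]
    obtain ⟨h1, h2⟩ := norm_apply_one_I_le (fderiv ℝ b' (z - c))
    exact ⟨h1.trans (hL' _), h2.trans (hL' _)⟩

end DFI1995

end Literature.NumberTheory.Sieve
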